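import Summits.NavierStokesRegularity.NavierStokesRegularity.Theorems.StrainDoorsTypeIAncientCompactness
import Literature.Analysis.FluidPDE.PineauVicolOneSliceHigherGradient
import Literature.Analysis.FluidPDE.NSVorticityBKMProofs
import HarnessLib

/-!
# Strain doors — CLASS-UNIFORM (`M`-ONLY) SLICE BOUNDS IN `A_M`: all derivatives, the vorticity-number ceiling,
# the vorticity Lipschitz modulus, and the «one point spreads to a parabolic ball» device

Helper lane of `stmt-NavierStokesRegularity-0056` (rung N0 of the NS ladder; NOTHING here is a claim about
Navier–Stokes regularity — these are a-priori bounds on the HYPOTHETICAL class `A_M` of KNSS-gauge Type-I ancient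
mild solutions `IsTypeIAncientMild M U`: jointly smooth on `(-∞,0) × ℝ³`, divergence free, Oseen-mild on every pair
of times, `|U(t,x)| ≤ M/√(−t)`).

ROUND 71 of the `ns-regularity-ideate` p1 line (door Y∞, `sliceVorticityFloorSupTypeI_holds`) names as the one
missing input of door Y proper (Y_meas: a superlevel-MEASURE floor `μ(M)(T−t)^{3/2}`) «an M-only LIPSCHITZ bound on
the rescaled vorticity in `A_M` … so that one point above `2η` spreads to a ball above `η`» (ROUND-71 memo §4).
This file supplies exactly that, in the lane's currency (`(0 − s)·|ω|` = the vorticity number, parabolic radii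
`r√(−s)`), with constants depending on `M` (and the order `k`) ONLY:

* §U1 `typeIAncientMild_uniform_iteratedFDeriv_bound M k`: ONE `K = K(M,k) ≥ 0` with
  `√(−t)^{k+1} ‖Dᵏ U(t,·)(x)‖ ≤ K` for every `U ∈ A_M`, every `t < 0`, every `x` — KNSS 2009 (4.10) on the window
  `[−2,−1/2)` for the whole class (the tree's `exists_norm_iteratedFDeriv_le_of_typeI`, cone-free) at the slice
  `−1` of the normalised field `λU(λ²·, λ· + x)`, `λ = √(−t)` (`IsTypeIAncientMild.comp_add_right`, `.nsRescale`),
  transported back by the dilation estimate `norm_iteratedFDeriv_smul_comp_smul_sub_le`.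
* §U2 the scale-invariant GRADIENT NUMBER ceiling `(0 − s)‖∇U(s,y)‖ ≤ K₁(M)` and VORTICITY NUMBER ceiling
  `(0 − s)|ω_U(s,y)| ≤ W(M)` (`|curl v| ≤ 4‖∇v‖`), and the vorticity LIPSCHITZ MODULUS
  `√(−s)³ |ω_U(s,y) − ω_U(s,x)| ≤ L(M)|y − x|` (mean value inequality with `‖∇ curl v‖ ≤ 4‖D²v‖`).
* §U3 ★ the SPREADING DEVICE `typeIAncientMild_vorticityNumber_spread`: `r = r(M,η) > 0` such that a point `x` with
  vorticity number `≥ 2η` at time `s` forces vorticity number `≥ η` on the whole parabolic ball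
  `closedBall x (r√(−s))`; set form + Lebesgue-measure form `typeIAncientMild_superlevel_contains_ball`.

Honest placement: §U1/§U2 are the KNSS 2009 Prop. 4.1/(4.10) bounds made class-uniform and scale-invariant — the
route `SqueezeCycle` has the `k = 1, 2` instances (`exists_gauge_norm_fderiv_le_of_typeI`,
`exists_gauge_norm_iteratedFDeriv_two_le_of_typeI`) inside its theses cone; here every order, cone-free, in the
StrainDoors namespace and currency; §U3 is two lines of calculus on top.  No new mechanism.

References: Koch–Nadirashvili–Seregin–Šverák, Acta Math. 203 (2009), Prop. 4.1, (4.10), §1 (1.2)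
(arXiv:0709.3599 pp. 2, 8); Giga–Miura, Comm. Math. Phys. 303 (2011) §2.1.
-/

noncomputable section

-- the summit and its single problem share the name `NavierStokesRegularity` (D-0017 nested layout)
set_option linter.dupNamespace false

-- nested operator types `ℝ³ →L[ℝ] ℝ³ →L[ℝ] …`
set_option maxSynthPendingDepth 3

open MeasureTheory Set Function Filter Metric Real
open _root_.Topology
open scoped ENNReal NNReal
open Literature.Analysis Literature.Analysis.FluidPDE

namespace Summit.NavierStokesRegularity.NavierStokesRegularity.Theorems.StrainDoors

/-! ### §U1 All derivatives, class-uniform and scale-invariant -/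

/-- ★ **CLASS-UNIFORM SCALE-INVARIANT DERIVATIVE BOUNDS IN `A_M`.**  For every `M` and every order `k` there is ONE
constant `K = K(M,k) ≥ 0` with `√(−t)^{k+1}·‖DᵏU(t,·)(x)‖ ≤ K` for EVERY `U ∈ A_M` (`IsTypeIAncientMild M U`), every
`t < 0` and every `x`.  KNSS (4.10) for the whole class on the window `[−2,−1/2)` at the slice `−1` of the normalised
field `λU(λ²s, λy + x)`, `λ = √(−t)`, which is again in `A_M`; then `U(t,y) = λ⁻¹W(−1)(λ⁻¹(y − x))`.
[cite: KochNadirashviliSereginSverak2009, Prop. 4.1 (4.10) and §1 (1.2) (arXiv:0709.3599 pp. 2, 8)] -/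
theorem typeIAncientMild_uniform_iteratedFDeriv_bound (M : ℝ) (k : ℕ) :
    ∃ K : ℝ, 0 ≤ K ∧ ∀ ⦃U : ℝ → EuclideanSpace ℝ (Fin 3) → EuclideanSpace ℝ (Fin 3)⦄, IsTypeIAncientMild M U →
      ∀ t : ℝ, t < 0 → ∀ x : EuclideanSpace ℝ (Fin 3), √(-t) ^ (k + 1) * ‖iteratedFDeriv ℝ k (U t) x‖ ≤ K := by
  obtain ⟨K, hK⟩ := exists_norm_iteratedFDeriv_le_of_typeI M k (a := -3) (b := -(1 / 2)) (δ := 1)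
    (by norm_num) (by norm_num) one_pos
  refine ⟨max K 0, le_max_right _ _, fun U hU t ht x => ?_⟩
  obtain ⟨c, hc_def⟩ : ∃ c : ℝ, c = √(-t) := ⟨_, rfl⟩
  have hc : 0 < c := by rw [hc_def]; exact Real.sqrt_pos.2 (neg_pos.2 ht)
  have hc2 : c ^ 2 = -t := by rw [hc_def]; exact Real.sq_sqrt (neg_pos.2 ht).le
  -- the normalised field `W(s,y) = c • U(c² s, c y + x)` is in `A_M`
  obtain ⟨W, hW_def⟩ : ∃ W : ℝ → EuclideanSpace ℝ (Fin 3) → EuclideanSpace ℝ (Fin 3),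
      W = nsRescale c (fun s y => U s (y + x)) := ⟨_, rfl⟩
  have hW : IsTypeIAncientMild M W := by rw [hW_def]; exact (hU.comp_add_right x).nsRescale hc
  -- KNSS (4.10) at the slice `-1 ∈ [-2, -1/2)` for the whole class
  have h1 : ∀ y, ‖iteratedFDeriv ℝ k (W (-1)) y‖ ≤ K := fun y =>
    hK hW.continuousOn_uncurry (fun s hs => hW.isWeaklyDivFree hs)
      (fun s r hsr hr y => hW.mild_eq_heatExtension hsr hr y) hW.hasTypeITimeDecay (-1)
      ⟨by norm_num, by norm_num⟩ y
  -- undo the normalisation: `U t = c⁻¹ • W(-1) (c⁻¹ • (· - x))`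
  have hslice : ∀ y, W (-1) y = c • U t (c • y + x) := fun y => by
    simp only [hW_def, nsRescale_apply, hc2, mul_neg, mul_one, neg_neg]
  have hUt : (fun y => c⁻¹ • W (-1) (c⁻¹ • (y - x))) = U t := by
    funext y
    rw [hslice, smul_smul c c⁻¹ (y - x), mul_inv_cancel₀ hc.ne', one_smul, sub_add_cancel, smul_smul,
      inv_mul_cancel₀ hc.ne', one_smul]
  have hsm : ContDiff ℝ (⊤ : ℕ∞) (W (-1)) := hW.contDiff_slice (by norm_num)
  have hsc := norm_iteratedFDeriv_smul_comp_smul_sub_le hsm c⁻¹ c⁻¹ x x k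
  rw [hUt, sub_self, smul_zero, abs_of_pos (inv_pos.2 hc)] at hsc
  have hck : c ^ (k + 1) * (c⁻¹ * c⁻¹ ^ k) = 1 := by
    rw [← pow_succ', ← mul_pow, mul_inv_cancel₀ hc.ne', one_pow]
  calc √(-t) ^ (k + 1) * ‖iteratedFDeriv ℝ k (U t) x‖ = c ^ (k + 1) * ‖iteratedFDeriv ℝ k (U t) x‖ := by
        rw [hc_def]
    _ ≤ c ^ (k + 1) * (c⁻¹ * c⁻¹ ^ k * ‖iteratedFDeriv ℝ k (W (-1)) 0‖) :=
        mul_le_mul_of_nonneg_left hsc (by positivity)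
    _ = ‖iteratedFDeriv ℝ k (W (-1)) 0‖ := by rw [← mul_assoc, hck, one_mul]
    _ ≤ K := h1 0
    _ ≤ max K 0 := le_max_left _ _

/-- The same bounds in divided form: `‖DᵏU(t,·)(x)‖ ≤ K / √(−t)^{k+1}`.
[cite: KochNadirashviliSereginSverak2009, Prop. 4.1 (4.10) (arXiv:0709.3599 p. 8)] -/
theorem typeIAncientMild_uniform_iteratedFDeriv_bound' (M : ℝ) (k : ℕ) :
    ∃ K : ℝ, 0 ≤ K ∧ ∀ ⦃U : ℝ → EuclideanSpace ℝ (Fin 3) → EuclideanSpace ℝ (Fin 3)⦄, IsTypeIAncientMild M U →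
      ∀ t : ℝ, t < 0 → ∀ x : EuclideanSpace ℝ (Fin 3), ‖iteratedFDeriv ℝ k (U t) x‖ ≤ K / √(-t) ^ (k + 1) := by
  obtain ⟨K, hK0, hK⟩ := typeIAncientMild_uniform_iteratedFDeriv_bound M k
  refine ⟨K, hK0, fun U hU t ht x => ?_⟩
  rw [le_div_iff₀ (pow_pos (Real.sqrt_pos.2 (neg_pos.2 ht)) _), mul_comm]
  exact hK hU t ht x

/-! ### §U2 Gradient number, vorticity number, vorticity Lipschitz modulus -/

/-- **Class-uniform GRADIENT-NUMBER ceiling in `A_M`**: `(0 − s)·‖∇U(s,y)‖ ≤ K₁(M)` for all `U ∈ A_M`, `s < 0`, `y`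
(§U1 with `k = 1`). [cite: KochNadirashviliSereginSverak2009, Prop. 4.1 (4.10) with k = 1 (arXiv:0709.3599 p. 8)] -/
theorem typeIAncientMild_uniform_gradNumber_bound (M : ℝ) :
    ∃ K₁ : ℝ, 0 ≤ K₁ ∧ ∀ ⦃U : ℝ → EuclideanSpace ℝ (Fin 3) → EuclideanSpace ℝ (Fin 3)⦄, IsTypeIAncientMild M U →
      ∀ s : ℝ, s < 0 → ∀ y : EuclideanSpace ℝ (Fin 3), (0 - s) * ‖fderiv ℝ (U s) y‖ ≤ K₁ := by
  obtain ⟨K, hK0, hK⟩ := typeIAncientMild_uniform_iteratedFDeriv_bound M 1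
  refine ⟨K, hK0, fun U hU s hs y => ?_⟩
  have h := hK hU s hs y
  have h2 : √(-s) ^ (1 + 1) = 0 - s := by
    rw [pow_succ, pow_one, Real.mul_self_sqrt (neg_pos.2 hs).le, zero_sub]
  rwa [norm_iteratedFDeriv_one, h2] at h

/-- ★ **Class-uniform VORTICITY-NUMBER ceiling in `A_M`**: there is `W = W(M) ≥ 0` with `(0 − s)·|ω_U(s,y)| ≤ W` for
all `U ∈ A_M`, `s < 0`, `y` (`|curl v| ≤ 4‖∇v‖`).  In particular the vorticity number of the class is bounded by a
constant depending on the Type-I rate only (companion of the FLOOR `η(M)` of `smallVorticityNumberLiouville_holds`).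
[cite: KochNadirashviliSereginSverak2009, Prop. 4.1 (4.10) with k = 1 (arXiv:0709.3599 p. 8); GigaMiura2011, §2.1] -/
theorem typeIAncientMild_uniform_vorticityNumber_bound (M : ℝ) :
    ∃ W : ℝ, 0 ≤ W ∧ ∀ ⦃U : ℝ → EuclideanSpace ℝ (Fin 3) → EuclideanSpace ℝ (Fin 3)⦄, IsTypeIAncientMild M U →
      ∀ s : ℝ, s < 0 → ∀ y : EuclideanSpace ℝ (Fin 3), (0 - s) * ‖curl (U s) y‖ ≤ W := by
  obtain ⟨K₁, hK0, hK⟩ := typeIAncientMild_uniform_gradNumber_bound M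
  refine ⟨4 * K₁, by positivity, fun U hU s hs y => ?_⟩
  have hs' : 0 ≤ 0 - s := by linarith
  calc (0 - s) * ‖curl (U s) y‖ ≤ (0 - s) * (4 * ‖fderiv ℝ (U s) y‖) :=
        mul_le_mul_of_nonneg_left (norm_curl_le_four_mul (U s) y) hs'
    _ = 4 * ((0 - s) * ‖fderiv ℝ (U s) y‖) := by ring
    _ ≤ 4 * K₁ := by gcongr; exact hK hU s hs y

/-- ★ **Class-uniform VORTICITY LIPSCHITZ MODULUS in `A_M`** (the «M-only Lipschitz bound on the rescaled vorticity»
asked for by ROUND 71 §4): there is `L = L(M) ≥ 0` with `√(−s)³·|ω_U(s,y) − ω_U(s,x)| ≤ L·|y − x|` for all `U ∈ A_M`,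
`s < 0`, `x, y` (mean value inequality with `‖∇ curl U(s)‖ ≤ 4‖D²U(s)‖ ≤ 4K₂(M)/√(−s)³`).
[cite: KochNadirashviliSereginSverak2009, Prop. 4.1 (4.10) with k = 2 (arXiv:0709.3599 p. 8)] -/
theorem typeIAncientMild_uniform_curl_lipschitz (M : ℝ) :
    ∃ L : ℝ, 0 ≤ L ∧ ∀ ⦃U : ℝ → EuclideanSpace ℝ (Fin 3) → EuclideanSpace ℝ (Fin 3)⦄, IsTypeIAncientMild M U →
      ∀ s : ℝ, s < 0 → ∀ x y : EuclideanSpace ℝ (Fin 3),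
        √(-s) ^ 3 * ‖curl (U s) y - curl (U s) x‖ ≤ L * ‖y - x‖ := by
  obtain ⟨K₂, hK0, hK⟩ := typeIAncientMild_uniform_iteratedFDeriv_bound M 2
  refine ⟨4 * K₂, by positivity, fun U hU s hs x y => ?_⟩
  have hc : 0 < √(-s) := Real.sqrt_pos.2 (neg_pos.2 hs)
  have hsm : ContDiff ℝ (⊤ : ℕ∞) (U s) := hU.contDiff_slice hs
  have hω : ContDiff ℝ 1 (curl (U s)) := contDiff_curl (n := 1) (hsm.of_le (by exact_mod_cast le_top))
  have hD : ∀ z : EuclideanSpace ℝ (Fin 3), ‖fderiv ℝ (curl (U s)) z‖ ≤ 4 * K₂ / √(-s) ^ 3 := fun z => by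
    rw [← norm_iteratedFDeriv_one (𝕜 := ℝ), le_div_iff₀ (pow_pos hc 3)]
    calc ‖iteratedFDeriv ℝ 1 (curl (U s)) z‖ * √(-s) ^ 3 ≤ 4 * ‖iteratedFDeriv ℝ 2 (U s) z‖ * √(-s) ^ 3 := by
          gcongr; exact norm_iteratedFDeriv_curl_le_four_mul hsm 1 z
      _ = 4 * (√(-s) ^ (2 + 1) * ‖iteratedFDeriv ℝ 2 (U s) z‖) := by ring
      _ ≤ 4 * K₂ := by gcongr; exact hK hU s hs z
  have hmv := Convex.norm_image_sub_le_of_norm_fderiv_le (fun z _ => (hω.differentiable one_ne_zero) z)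
    (fun z _ => hD z) convex_univ (mem_univ x) (mem_univ y)
  calc √(-s) ^ 3 * ‖curl (U s) y - curl (U s) x‖ ≤ √(-s) ^ 3 * (4 * K₂ / √(-s) ^ 3 * ‖y - x‖) :=
        mul_le_mul_of_nonneg_left hmv (by positivity)
    _ = 4 * K₂ * ‖y - x‖ := by field_simp

/-! ### §U3 The spreading device: one point above `2η` ⇒ a parabolic ball above `η` -/

/-- ★★ **THE SPREADING DEVICE** (ROUND 71 §4, input of door Y / Y_meas): for every `M` and `η > 0` there is
`r = r(M,η) > 0` such that for every `U ∈ A_M`, every `s < 0` and every point `x` with vorticity number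
`(0 − s)|ω_U(s,x)| ≥ 2η`, EVERY point of the parabolic ball `closedBall x (r√(−s))` has vorticity number `≥ η`
(`r = η/(L(M)+1)`, `L` the vorticity Lipschitz modulus of §U2). [new-as-typed; folklore calculus on KNSS (4.10)] -/
theorem typeIAncientMild_vorticityNumber_spread (M : ℝ) {η : ℝ} (hη : 0 < η) :
    ∃ r : ℝ, 0 < r ∧ ∀ ⦃U : ℝ → EuclideanSpace ℝ (Fin 3) → EuclideanSpace ℝ (Fin 3)⦄, IsTypeIAncientMild M U →
      ∀ s : ℝ, s < 0 → ∀ x : EuclideanSpace ℝ (Fin 3), 2 * η ≤ (0 - s) * ‖curl (U s) x‖ →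
        ∀ y ∈ closedBall x (r * √(-s)), η ≤ (0 - s) * ‖curl (U s) y‖ := by
  obtain ⟨L, hL0, hL⟩ := typeIAncientMild_uniform_curl_lipschitz M
  refine ⟨η / (L + 1), by positivity, fun U hU s hs x hx y hy => ?_⟩
  have hc : 0 < √(-s) := Real.sqrt_pos.2 (neg_pos.2 hs)
  have hc2 : √(-s) ^ 2 = 0 - s := by rw [Real.sq_sqrt (neg_pos.2 hs).le, zero_sub]
  have hdist : ‖y - x‖ ≤ η / (L + 1) * √(-s) := mem_closedBall_iff_norm.1 hy
  have hlip := hL hU s hs x y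
  -- the oscillation of the vorticity number over the parabolic ball is at most `η`
  have key : (0 - s) * ‖curl (U s) y - curl (U s) x‖ ≤ η := by
    have h1 : √(-s) * ((0 - s) * ‖curl (U s) y - curl (U s) x‖) ≤ √(-s) * η := by
      calc √(-s) * ((0 - s) * ‖curl (U s) y - curl (U s) x‖)
          = √(-s) ^ 3 * ‖curl (U s) y - curl (U s) x‖ := by rw [← hc2]; ring
        _ ≤ L * ‖y - x‖ := hlip
        _ ≤ L * (η / (L + 1) * √(-s)) := by gcongr
        _ = L / (L + 1) * η * √(-s) := by ring
        _ ≤ 1 * η * √(-s) := by gcongr; exact (div_le_one (by positivity)).2 (by linarith)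
        _ = √(-s) * η := by ring
    exact le_of_mul_le_mul_left h1 hc
  have hs' : 0 ≤ 0 - s := by linarith
  have htri : ‖curl (U s) x‖ ≤ ‖curl (U s) y‖ + ‖curl (U s) y - curl (U s) x‖ :=
    calc ‖curl (U s) x‖ = ‖curl (U s) y - (curl (U s) y - curl (U s) x)‖ := by rw [sub_sub_cancel]
      _ ≤ ‖curl (U s) y‖ + ‖curl (U s) y - curl (U s) x‖ := norm_sub_le _ _
  have h3 : (0 - s) * ‖curl (U s) x‖ ≤ (0 - s) * ‖curl (U s) y‖ + (0 - s) * ‖curl (U s) y - curl (U s) x‖ := by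
    rw [← mul_add]; exact mul_le_mul_of_nonneg_left htri hs'
  linarith

/-- ★★ **Set / measure form of the spreading device**: under the same hypotheses the parabolic ball
`closedBall x (r√(−s))` is CONTAINED in the superlevel set `{(0 − s)|ω_U(s,·)| ≥ η}`, hence that set has Lebesgue
measure at least `volume (closedBall x (r√(−s)))` (`= (4π/3) r³ (−s)^{3/2}`): the superlevel-measure floor of door
Y_meas at the level of the class `A_M`. [new-as-typed; folklore] -/
theorem typeIAncientMild_superlevel_contains_ball (M : ℝ) {η : ℝ} (hη : 0 < η) :
    ∃ r : ℝ, 0 < r ∧ ∀ ⦃U : ℝ → EuclideanSpace ℝ (Fin 3) → EuclideanSpace ℝ (Fin 3)⦄, IsTypeIAncientMild M U →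
      ∀ s : ℝ, s < 0 → ∀ x : EuclideanSpace ℝ (Fin 3), 2 * η ≤ (0 - s) * ‖curl (U s) x‖ →
        closedBall x (r * √(-s)) ⊆ {y | η ≤ (0 - s) * ‖curl (U s) y‖} ∧
          volume (closedBall x (r * √(-s))) ≤ volume {y | η ≤ (0 - s) * ‖curl (U s) y‖} := by
  obtain ⟨r, hr, h⟩ := typeIAncientMild_vorticityNumber_spread M hη
  refine ⟨r, hr, fun U hU s hs x hx => ?_⟩
  have hsub : closedBall x (r * √(-s)) ⊆ {y | η ≤ (0 - s) * ‖curl (U s) y‖} :=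
    fun y hy => h hU s hs x hx y hy
  exact ⟨hsub, measure_mono hsub⟩

end Summit.NavierStokesRegularity.NavierStokesRegularity.Theorems.StrainDoors

end
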